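import Literature.Combinatorics.Optimization.ShellLawPinning
import HarnessLib

/-!
# Pointwise comparability of a shell law with the shell laws of one-edge-deleted ground sets

Fix a perfect matching (`π` its fixed-point-free partner involution), a `π`-stable ground set `S`, a block `H`,
a vertex `v ∈ S` with edge `e = {v, πv}`. The shell law of the block statistic `X = |U ∩ H|`
(`law_S(t,c;x) = Sh_S(t,c;x)/|Shell_S(t,c)|`, `ShellLawLevelStep`) dominates, ATOM BY ATOM and with a constant
factor, the shell laws of the ground set with the edge `e` deleted:

* §1 counts: **`shellCount_sdiff_pair_shift_le`** — `Sh_{S∖e}(t,c; x − |e∩H|) ≤ Sh_S(t+2,c; x)` (the cuts of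
  `Shell_S(t+2,c)` containing `e` as a FULL edge are `W ∪ e`, `W ∈ Shell_{S∖e}(t,c)`, with `X` shifted by `|e∩H|`;
  tree `card_shellIn_full_filter`); **`shellCount_sdiff_pair_le`** — `Sh_{S∖e}(t,c;x) ≤ Sh_S(t,c;x)` (the cuts
  AVOIDING `e`; tree `card_shellIn_avoid_filter`).
* §2 **`card_shellIn_sdiff_pair_avoid_ratio`** — `|S|·|Shell_{S∖e}(t,c)| = (|S| − t − c)·|Shell_S(t,c)|`: the
  probability that a given edge is EMPTY under the uniform cut of `Shell_S(t,c)` is `(number of empty edges)/N`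
  (double counting (cut, empty edge) with `|freeIn_S U| = |S| − t − c`, tree `card_half_add_card_freeIn`, and
  `card_shellIn_eq_of_card_eq`); the FULL-edge analogue `|S|·|Shell_{S∖e}(t,c)| = (t+2−c)·|Shell_S(t+2,c)|` is the
  tree's `card_shellIn_sdiff_pair_ratio`.
* §3 THE COMPARABILITY INEQUALITIES: **`shellLaw_sdiff_pair_shift_le`** —
  `((t+2−c)/|S|)·law_{S∖e}(t,c; x − |e∩H|) ≤ law_S(t+2,c; x)` and **`shellLaw_sdiff_pair_le`** —
  `((|S|−t−c)/|S|)·law_{S∖e}(t,c; x) ≤ law_S(t,c; x)`, for every edge `e ⊆ S`, every level `c` and every `x ∈ ℤ`.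
  For balanced cuts both prefactors are `≥ β > 0`, so a `k`-fold deleted law at a shifted point is `≤ β^{−k}` times
  the original law at the original point — the constant-loss COMPARABILITY step (e) of the bulk input of cell
  pnp-psdrank's virtual-positivity criterion (Theorems brick 121; MEMO-26 §3), where the iterated level step
  (`ShellLawSmoothing.sum_abs_nab2_iter_fwdDiff_iter_le` with a singleton window) produces `x`-differences of
  `k`-fold deleted laws that must be compared with the undeleted law at the same point.

All PROVED, 0 sorry, no definitions, no named facts; bookkeeping on Rothvoß's slack-matrix combinatorics
[Rothvoß 2017, §2].

## References
* [Rothvoss2017] T. Rothvoß, *The matching polytope has exponential extension complexity*, J. ACM 64 (2017), §2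
  (PDF pp. 5–6): cuts `U`, the partition of a cut by a perfect matching into full / half / empty edges.
* [GodsilMeagher2015] C. Godsil, K. Meagher, *Erdős–Ko–Rado Theorems: Algebraic Approaches* (2015), §15.2
  (perfect matchings as fixed-point-free involutions).
-/

noncomputable section

open Finset

namespace Literature.Combinatorics.Optimization

namespace ShellStep

variable {n : ℕ} {π : Fin n → Fin n}

section Deletion

variable (hπ : ∀ v, π (π v) = v) (hπ' : ∀ v, π v ≠ v)
include hπ hπ'

/-! ### §1 Counts: deleting one edge, full or empty -/

/-- **Full-edge pin, shifted count**: `Sh_{S∖e}(t,c; x − |e∩H|) ≤ Sh_S(t+2,c; x)` for the edge `e = {v, πv}` of a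
vertex `v ∈ S`: every `W ∈ Shell_{S∖e}(t,c)` with `|W∩H| = x − |e∩H|` gives the cut `W ∪ e ∈ Shell_S(t+2,c)` with
`|U∩H| = x`. [cite: Rothvoss2017, §2 (PDF p. 6)] -/
theorem shellCount_sdiff_pair_shift_le {S : Finset (Fin n)} (hS : ∀ u ∈ S, π u ∈ S) {v : Fin n} (hv : v ∈ S)
    (H : Finset (Fin n)) (t c : ℕ) (x : ℤ) :
    shellCount π (S \ {v, π v}) H t c (x - ((({v, π v} : Finset (Fin n)) ∩ H).card : ℤ)) ≤
      shellCount π S H (t + 2) c x := by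
  rw [shellCount, shellCount]
  have hkey := card_shellIn_full_filter hπ hπ' hS hv t c
    (fun W => ((W ∩ H).card : ℤ) = x - ((({v, π v} : Finset (Fin n)) ∩ H).card : ℤ))
  rw [← hkey]
  exact_mod_cast card_le_card (fun U hU => by
    rw [mem_filter] at hU ⊢
    obtain ⟨hUsh, hvU, hπvU, hX⟩ := hU
    refine ⟨hUsh, ?_⟩
    -- `|(U ∖ e) ∩ H| + |e ∩ H| = |U ∩ H|` since `e ⊆ U`
    have hsub : ({v, π v} : Finset (Fin n)) ⊆ U := by
      intro u hu
      rcases mem_insert.1 hu with rfl | h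
      · exact hvU
      · rw [mem_singleton.1 h]; exact hπvU
    have hsplit : ((U \ {v, π v}) ∩ H).card + (({v, π v} : Finset (Fin n)) ∩ H).card = (U ∩ H).card := by
      rw [← card_union_of_disjoint (disjoint_left.2 fun u hu hu' => (mem_sdiff.1 (mem_inter.1 hu).1).2 (mem_inter.1 hu').1),
        ← union_inter_distrib_right, sdiff_union_of_subset hsub]
    have : (((U \ {v, π v}) ∩ H).card : ℤ) + ((({v, π v} : Finset (Fin n)) ∩ H).card : ℤ) = ((U ∩ H).card : ℤ) := by
      exact_mod_cast hsplit
    omega)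

omit hπ hπ' in
/-- **Empty-edge count**: `Sh_{S∖e}(t,c; x) ≤ Sh_S(t,c; x)` — the cuts avoiding the edge `e = {v, πv}` are the cuts
of the deleted ground set. [cite: Rothvoss2017, §2 (PDF p. 6)] -/
theorem shellCount_sdiff_pair_le (S : Finset (Fin n)) (v : Fin n) (H : Finset (Fin n)) (t c : ℕ) (x : ℤ) :
    shellCount π (S \ {v, π v}) H t c x ≤ shellCount π S H t c x := by
  rw [shellCount, shellCount]
  have hkey := card_shellIn_avoid_filter (π := π) (S := S) v t c (fun W => ((W ∩ H).card : ℤ) = x)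
  rw [← hkey]
  exact_mod_cast card_le_card (fun U hU => by
    rw [mem_filter] at hU ⊢
    exact ⟨hU.1, hU.2.2.2⟩)

/-! ### §2 The empty-edge ratio -/

/-- **Empty-edge ratio**: `|S|·|Shell_{S∖e}(t,c)| = (|S| − t − c)·|Shell_S(t,c)|` for an edge `e = {v, πv}` of
`v ∈ S` — the probability that a given edge is empty under the uniform cut of `Shell_S(t,c)` is
`(|S| − t − c)/|S|` (double counting the pairs (cut, empty edge); every cut of the shell has `|S| − t − c`
vertices on empty edges). [cite: Rothvoss2017, §2 (PDF p. 6)] -/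
theorem card_shellIn_sdiff_pair_avoid_ratio {S : Finset (Fin n)} (hS : ∀ u ∈ S, π u ∈ S) {v : Fin n}
    (hv : v ∈ S) (t c : ℕ) :
    (S.card : ℝ) * (shellIn π (S \ {v, π v}) t c).card =
      ((S.card : ℝ) - t - c) * (shellIn π S t c).card := by
  -- every `u ∈ S` gives the same count `#{U : u, πu ∉ U} = |Shell_{S∖e_u}(t,c)| = |Shell_{S∖e_v}(t,c)|`
  have hcount : ∀ u ∈ S, (((shellIn π S t c).filter fun U => u ∉ U ∧ π u ∉ U).card : ℝ) =
      (shellIn π (S \ {v, π v}) t c).card := by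
    intro u hu
    rw [card_shellIn_avoid]
    have e := card_shellIn_eq_of_card_eq hπ hπ' ((S \ {u, π u}).card) (S₁ := S \ {u, π u})
      (S₂ := S \ {v, π v}) rfl (by
        have h1 := card_sdiff_pair hπ' hS hu
        have h2 := card_sdiff_pair hπ' hS hv
        omega) (sdiff_pair_stable hπ hS u) (sdiff_pair_stable hπ hS v) t c
    exact_mod_cast e
  have hlhs : (S.card : ℝ) * (shellIn π (S \ {v, π v}) t c).card =
      ∑ u ∈ S, (((shellIn π S t c).filter fun U => u ∉ U ∧ π u ∉ U).card : ℝ) := by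
    rw [sum_congr rfl hcount, sum_const, nsmul_eq_mul]
  rw [hlhs]
  -- swap the double count: `Σ_u #{U : u,πu ∉ U} = Σ_U |freeIn_S U|`
  have hswap : ∑ u ∈ S, (((shellIn π S t c).filter fun U => u ∉ U ∧ π u ∉ U).card : ℝ) =
      ∑ U ∈ shellIn π S t c, ((freeIn π S U).card : ℝ) := by
    have eL : ∀ u ∈ S, (((shellIn π S t c).filter fun U => u ∉ U ∧ π u ∉ U).card : ℝ) =
        ∑ U ∈ shellIn π S t c, if (u ∉ U ∧ π u ∉ U) then (1 : ℝ) else 0 := by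
      intro u _
      rw [card_filter]; push_cast
      exact sum_congr rfl fun U _ => by split_ifs <;> simp
    have eR : ∀ U ∈ shellIn π S t c, ((freeIn π S U).card : ℝ) =
        ∑ u ∈ S, if (u ∉ U ∧ π u ∉ U) then (1 : ℝ) else 0 := by
      intro U _
      rw [freeIn, card_filter]; push_cast
      rw [sdiff_eq_filter, sum_filter]
      refine sum_congr rfl fun u _ => ?_
      by_cases h1 : u ∈ U <;> by_cases h2 : π u ∈ U <;> simp [h1, h2]
    rw [sum_congr rfl eL, sum_congr rfl eR, sum_comm]
  rw [hswap]
  have hfree : ∀ U ∈ shellIn π S t c, ((freeIn π S U).card : ℝ) = (S.card : ℝ) - t - c := by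
    intro U hU
    obtain ⟨hUS, hUt, hUc⟩ := mem_shellIn.1 hU
    have h := card_half_add_card_freeIn hπ hS hUS
    have hle : U.card ≤ S.card := card_le_card hUS
    have : ((half π U).card : ℝ) + (freeIn π S U).card = (S.card : ℝ) - U.card := by
      rw [← Nat.cast_add, h, Nat.cast_sub hle]
    rw [hUt, hUc] at this
    linarith
  rw [sum_congr rfl hfree, sum_const, nsmul_eq_mul]
  ring

/-! ### §3 The comparability inequalities for the laws -/

omit hπ hπ' in
/-- Shell laws are nonnegative. [cite: Rothvoss2017, §2 (PDF p. 6)] -/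
theorem shellLaw_nonneg (S H : Finset (Fin n)) (t c : ℕ) (x : ℤ) : 0 ≤ shellLaw π S H t c x := by
  rw [shellLaw, shellCount]; positivity

/-- **Comparability under deleting a FULL edge**: for every edge `e = {v, πv} ⊆ S`, level `c`, `x ∈ ℤ`:
`((t+2−c)/|S|)·law_{S∖e}(t,c; x − |e∩H|) ≤ law_S(t+2,c; x)`. [cite: Rothvoss2017, §2 (PDF p. 6)] -/
theorem shellLaw_sdiff_pair_shift_le {S : Finset (Fin n)} (hS : ∀ u ∈ S, π u ∈ S) {v : Fin n} (hv : v ∈ S)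
    (H : Finset (Fin n)) (t c : ℕ) (x : ℤ) :
    ((t : ℝ) + 2 - c) / S.card * shellLaw π (S \ {v, π v}) H t c (x - ((({v, π v} : Finset (Fin n)) ∩ H).card : ℤ)) ≤
      shellLaw π S H (t + 2) c x := by
  have hratio := card_shellIn_sdiff_pair_ratio hπ hπ' hS hv t c
  have hcount := shellCount_sdiff_pair_shift_le hπ hπ' hS hv H t c x
  have hS0 : (0 : ℝ) < S.card := by
    have : 0 < S.card := card_pos.2 ⟨v, hv⟩
    exact_mod_cast this
  by_cases hne : (shellIn π S (t + 2) c).card = 0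
  · -- empty big shell ⇒ empty deleted shell ⇒ both laws vanish
    have h0 : ((shellIn π (S \ {v, π v}) t c).card : ℝ) = 0 := by
      have : (S.card : ℝ) * (shellIn π (S \ {v, π v}) t c).card = 0 := by rw [hratio, hne]; simp
      rcases mul_eq_zero.1 this with h | h
      · exact absurd h hS0.ne'
      · exact h
    have hlaw0 : shellLaw π (S \ {v, π v}) H t c (x - ((({v, π v} : Finset (Fin n)) ∩ H).card : ℤ)) = 0 := by
      rw [shellLaw, h0, div_zero]
    rw [hlaw0, mul_zero]
    exact shellLaw_nonneg _ _ _ _ _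
  · have hpos : (0 : ℝ) < (shellIn π S (t + 2) c).card := by
      have : 0 < (shellIn π S (t + 2) c).card := Nat.pos_of_ne_zero hne
      exact_mod_cast this
    -- `law_S(x) = Sh_S(x)/|Shell_S| ≥ Sh'(x−h)/|Shell_S| = law'·|Shell'|/|Shell_S| = law'·(t+2−c)/|S|`
    rw [show shellLaw π S H (t + 2) c x = shellCount π S H (t + 2) c x / ((shellIn π S (t + 2) c).card : ℝ) from rfl,
      le_div_iff₀ hpos]
    have hShell' : ((shellIn π (S \ {v, π v}) t c).card : ℝ) = ((t : ℝ) + 2 - c) * (shellIn π S (t + 2) c).card / S.card := by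
      rw [eq_div_iff hS0.ne', mul_comm]; exact hratio
    calc ((t : ℝ) + 2 - c) / S.card * shellLaw π (S \ {v, π v}) H t c (x - ((({v, π v} : Finset (Fin n)) ∩ H).card : ℤ)) *
          (shellIn π S (t + 2) c).card
        = ((shellIn π (S \ {v, π v}) t c).card : ℝ) *
            shellLaw π (S \ {v, π v}) H t c (x - ((({v, π v} : Finset (Fin n)) ∩ H).card : ℤ)) := by
          rw [hShell']; field_simp
      _ = shellCount π (S \ {v, π v}) H t c (x - ((({v, π v} : Finset (Fin n)) ∩ H).card : ℤ)) :=
          (shellCount_eq_card_mul_shellLaw _ _ _ _ _).symm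
      _ ≤ shellCount π S H (t + 2) c x := hcount

/-- **Comparability under deleting an EMPTY edge**: for every edge `e = {v, πv} ⊆ S`, level `c`, `x ∈ ℤ`:
`((|S| − t − c)/|S|)·law_{S∖e}(t,c; x) ≤ law_S(t,c; x)`. [cite: Rothvoss2017, §2 (PDF p. 6)] -/
theorem shellLaw_sdiff_pair_le {S : Finset (Fin n)} (hS : ∀ u ∈ S, π u ∈ S) {v : Fin n} (hv : v ∈ S)
    (H : Finset (Fin n)) (t c : ℕ) (x : ℤ) :
    ((S.card : ℝ) - t - c) / S.card * shellLaw π (S \ {v, π v}) H t c x ≤ shellLaw π S H t c x := by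
  have hratio := card_shellIn_sdiff_pair_avoid_ratio hπ hπ' hS hv t c
  have hcount := shellCount_sdiff_pair_le (π := π) S v H t c x
  have hS0 : (0 : ℝ) < S.card := by
    have : 0 < S.card := card_pos.2 ⟨v, hv⟩
    exact_mod_cast this
  by_cases hne : (shellIn π S t c).card = 0
  · have hsub : shellIn π (S \ {v, π v}) t c ⊆ shellIn π S t c := by
      intro U hU
      rw [mem_shellIn] at hU ⊢
      exact ⟨hU.1.trans sdiff_subset, hU.2⟩
    have h0 : (shellIn π (S \ {v, π v}) t c).card = 0 :=
      Nat.eq_zero_of_le_zero ((card_le_card hsub).trans (le_of_eq hne))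
    have hlaw0 : shellLaw π (S \ {v, π v}) H t c x = 0 := by
      rw [shellLaw, h0, Nat.cast_zero, div_zero]
    rw [hlaw0, mul_zero]
    exact shellLaw_nonneg _ _ _ _ _
  · have hpos : (0 : ℝ) < (shellIn π S t c).card := by
      have : 0 < (shellIn π S t c).card := Nat.pos_of_ne_zero hne
      exact_mod_cast this
    rw [show shellLaw π S H t c x = shellCount π S H t c x / ((shellIn π S t c).card : ℝ) from rfl, le_div_iff₀ hpos]
    have hShell' : ((shellIn π (S \ {v, π v}) t c).card : ℝ) = ((S.card : ℝ) - t - c) * (shellIn π S t c).card / S.card := by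
      rw [eq_div_iff hS0.ne', mul_comm]; exact hratio
    calc ((S.card : ℝ) - t - c) / S.card * shellLaw π (S \ {v, π v}) H t c x * (shellIn π S t c).card
        = ((shellIn π (S \ {v, π v}) t c).card : ℝ) * shellLaw π (S \ {v, π v}) H t c x := by
          rw [hShell']; field_simp
      _ = shellCount π (S \ {v, π v}) H t c x := (shellCount_eq_card_mul_shellLaw _ _ _ _ _).symm
      _ ≤ shellCount π S H t c x := hcount

end Deletion

end ShellStep

end Literature.Combinatorics.Optimization
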